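/-
Origin: expansion seat `planner-pub-hodgecm-mc-glue-1-g11-0`, handover #SG40 2026-08-20T16:55:47Z md5 b61eaadfae32 (REPLACE; pre md5 70d42f8a6966 → new md5 b61eaadfae32; 136 l.; (μ4) scope-guard rewrite of the RUN-55 installed file; family glue-1; compiled ok 0 proof-hole) (`HOME/mc/pub-hodgecm-mc-glue-1-g11/stage56/HodgeCM/Model/E2InstanceOGR21AEPISTRDS.lean`, md5 b61eaadfae32, 136 lines);
landed by the second packager p2 gen 10 (p2-g10) in gate run 56 REPLACES the earlier landed copy of `HodgeCM/Model/E2InstanceOGR21AEPISTRDS.lean` (seat copy carried the packager Origin header of an earlier run (stripped)).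
-/
/-
Origin: CONSTRUCTION seat `planner-pub-hodgecm-mc-glue-1-g10-0` (unit pub-hodgecm-mc-glue-1-g10, gen 10 of mc-glue-1, node E ASSEMBLER),
generated from glue-1's #397D `HodgeCM/Model/E2InstanceOGR21AEPISTRD.lean` (227275bf55c1) by `tools/gen_ogistrds.py`; KERNEL only: 1 theorem,
0 defs; intended closure {propext, Classical.choice, Quot.sound}.  The `μ♯♯` child: #397D with its three guarded (J-μ) identities `hΔ₁ hΔ₂ hΔ₃`
discharged at theta-3's RUN-48 (K10) adapter `ArchSideTerm.muSharp₂₃ μ` (`Model/ArchSlotDeltaDischarge23`) modulo ONE guarded family (SV);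
a closing-chain leaf beside E — record status is the lead's ruling, not this file's claim.
-/
import Summits.HodgeConjecture.HodgeCM.Model.E2InstanceOGR21AEPISTRD
import Summits.HodgeConjecture.HodgeCM.Model.ArchSlotDeltaDischarge23

noncomputable section

open scoped TensorProduct InnerProductSpace Matrix

open Literature.NumberTheory.Automorphic Literature.NumberTheory.Weil1964
open Literature.NumberTheory.GelbartRogawski1991.UnitaryDualPair
open HodgeCM.Adelic HodgeCM.PerL34
open scoped Classical
open Literature.Geometry.ComplexHyperbolic.BallModel (U21 x₀ stabilizerEquivK21)
open Literature.NumberTheory.Automorphic.U21 (K21 matA sclD)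

/-!
# E2InstanceOGR21AEPISTRDF — the full (R1) child with (J-μ)₁₂₃ discharged at the adapter `μ♯♯`, modulo (SV) = (STRIP) ∘ (VT)

`perL_picardCM_r21AEOGISTRDS` = `perL_picardCM_r21AEOGISTRD` (#397D, RUN 46, 17 binder groups
`hA W hGR hGR₀ hGR₁ hGR₂ hGR₃ μ hΔ₁ hΔ₂ hΔ₃ hR hΘ gen12 real34 hyp12 hyp34`) fed with
`μ := ArchSideTerm.muSharp₂₃ μ` (theta-3 (K10): `μ♯♯ c := update (update (μ♯ c) 2 (μ c 0 + slotDelta₂ c.D)) 3 (μ c 0 + slotDelta₃ c.D)`: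
the whole (J-μ) table pinned to theta-3's closed tables up to the common shift `μ c 0`),
`hΔ₁ := ArchSideTerm.hΔ₁_GOG_muSharp₂₃ …` (HYPOTHESIS-FREE, theta-3 (TD) `hΔ₁_GOG_muSharp`),
`hΔ₂ := ArchSideTerm.hΔ₂_GOG_muSharp₂₃ … hSV`, `hΔ₃ := ArchSideTerm.hΔ₃_GOG_muSharp₂₃ … hSV` (sinst-1 RUN-47 #1218
`slotTypeVec_two/three_sub_zero_apply_of_strip_vt` place by place).  NEW binder group **(SV)** `hSV` = #1218's two archimedean hypotheses (STRIP)
`X' = E(Y ⊗ F)` and (VT) `Y = a • ω_∞(1, conjTransportK c.D) Φ_X` as ONE guarded E-level family with the shared witness `Y` SUBSTITUTED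
(`∀ V c, GOG V c → ∃ F a, cmConjLineTensorFin … = E((a • ω_∞(1, conjTransportK c.D) (ctxSlotArchBox V c)) ⊗ F)`; owners: period-1 (STRIP)
CLAIM l.13056, (VT) = sinst-1 RUN-47 #1219–#1221 + period-1's W1–W3) — a HYPOTHESIS displayed as typed, NOT a claim that (STRIP)/(VT) hold.
Binder groups 17 → 15: `hA W hGR hGR₀ hGR₁ hGR₂ hGR₃ μ hSV hR hΘ gen12 real34 hyp12 hyp34` (`hΔ₁ hΔ₂ hΔ₃` out, `hSV` in); `μ` keeps its text
(only its column `μ c 0` still matters); the texts of `hR hΘ gen12 real34 hyp12 hyp34` are #397D's with `μ ↦ ArchSideTerm.muSharp₂₃ μ` and the pin's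
proof arguments `@μ hΔ₁ hΔ₂ hΔ₃ ↦ (ArchSideTerm.muSharp₂₃ @μ) (hΔ₁_GOG_muSharp₂₃ …) (hΔ₂_GOG_muSharp₂₃ … hSV) (hΔ₃_GOG_muSharp₂₃ … hSV)` (forced: the
pin `SInstance.SROGTC` is instantiated at `μ♯♯`); conclusion `Universe.PerL` unchanged; proof = ONE application of `perL_picardCM_r21AEOGISTRD`.
ADDITIVE LEAF; no new definition, record or cite enters here (the adapter `muSharp₂₃` and the three discharging theorems are theta-3's (K10) `Model/ArchSlotDeltaDischarge23`); nothing of PerL ∕ QW8 is claimed.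
-/

namespace HodgeCM

namespace Model

open HodgeCM.Model.ArchSideTerm
open scoped SchwartzMap
open NumberField.mixedEmbedding (mixedSpace)
open HodgeCM.Universe (AdelicThetaCore AdelicThetaCore₀ SideData ThetaModel ModelAxiomsPerL)
open Literature.AlgebraicGeometry.HodgeTheory
open Literature.AlgebraicGeometry.ComplexMultiplication (Shimura1998_Thm3_isogenousPower Shimura1998_Thm2_Cor)
open Literature.NumberTheory.Automorphic.PicardCM
open Literature.NumberTheory.Transcendental (Arapura2012_Cor_15_4_6)
open HodgeCM.CMTypeOps (inflate)
open HodgeCM.Model.SupplyResidual (ClassSupplyPackN)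
open HodgeCM.Model.ThetaSpace

variable (hHD : exists_isReal_hodgeModel) (hI : hodgePQ_independent_of_hodgeModel)
  (h₁ : BallQuotientUniformised)  (h₃ : CMAbelianVarietyEigenbasisRealised)

/-- **THE FULL (R1) CHILD AT `μ♯♯`** ((J-μ)₁₂₃ discharged modulo (SV); 15 binder groups `hA W hGR hGR₀ hGR₁ hGR₂ hGR₃ μ hSV hR hΘ gen12 real34
hyp12 hyp34`, the last six re-texted `μ ↦ ArchSideTerm.muSharp₂₃ μ`). -/
theorem perL_picardCM_r21AEOGISTRDS (hA : Arapura2012_Cor_15_4_6)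
    (W : ∀ {L : CMField} {ι₁ : L →+* ℂ} (V : HermSpace3 L ι₁) (c : SeesawCtx L), WmInput V c.D)
    (hGR : ∀ {L : CMField} {ι₁ : L →+* ℂ} (V : HermSpace3 L ι₁) (c : SeesawCtx L),
      (cmSplittingDatum (L : Type) finProdFinEquiv (frameD V) (frameD_real V) (frameD_ne V) (dW c.D) (dW_real c.D)
        (dW_ne c.D)).CompatibleSplitting)
    (hGR₀ : ∀ {L : CMField} {ι₁ : L →+* ℂ} (V : HermSpace3 L ι₁) (c : SeesawCtx L),
      (cmSplittingDatum (L : Type) (e₁) (frameD V) (frameD_real V) (frameD_ne V) (lineVec (L : Type) (dW c.D 0))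
        (fun _ => dW_real c.D 0) (fun _ => dW_ne c.D 0)).CompatibleSplitting)
    (hGR₁ : ∀ {L : CMField} {ι₁ : L →+* ℂ} (V : HermSpace3 L ι₁) (c : SeesawCtx L),
      (cmSplittingDatum (L : Type) (e₁) (frameD V) (frameD_real V) (frameD_ne V) (lineVec (L : Type) (dW c.D 1))
        (fun _ => dW_real c.D 1) (fun _ => dW_ne c.D 1)).CompatibleSplitting)
    (hGR₂ : ∀ {L : CMField} {ι₁ : L →+* ℂ} (V : HermSpace3 L ι₁) (c : SeesawCtx L),
      (cmSplittingDatum (L : Type) (e₁) (frameD V) (frameD_real V) (frameD_ne V) (lineVec (L : Type) (dW' c.D 0))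
        (fun _ => dW'_real c.D 0) (fun _ => dW'_ne c.D 0)).CompatibleSplitting)
    (hGR₃ : ∀ {L : CMField} {ι₁ : L →+* ℂ} (V : HermSpace3 L ι₁) (c : SeesawCtx L),
      (cmSplittingDatum (L : Type) (e₁) (frameD V) (frameD_real V) (frameD_ne V) (lineVec (L : Type) (dW' c.D 1))
        (fun _ => dW'_real c.D 1) (fun _ => dW'_ne c.D 1)).CompatibleSplitting)
    (μ : ∀ {L : CMField}, SeesawCtx L → Fin 4 → NumberField.InfinitePlace L → ℤ)
    (hSV : ∀ {L : CMField} {ι₁ : L →+* ℂ} (V : HermSpace3 L ι₁) (c : SeesawCtx L) (hc : SInstance.GOG V c),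
      ∃ (Y : 𝓢((Fin (3 * 2) → mixedSpace (↥(NumberField.maximalRealSubfield (L : Type)))), ℂ))
        (F : FinSB (↥(NumberField.maximalRealSubfield (L : Type))) (Fin (3 * 2))) (a : ℂ),
        cmConjLineTensorFin (L : Type) finProdFinEquiv e₁ (frameD V) (frameD_real V) (frameD_ne V) (dW c.D) (dW_real c.D) (dW_ne c.D)
            (dW' c.D) (dW'_real c.D) (dW'_ne c.D) c.D.isoGL (isoGL_hg₀ c.D)
            (SupplyInstance.testFun (↥(NumberField.maximalRealSubfield (L : Type))) (Fin 3)
              (linePhi V (dW' c.D 0) (dW'_real c.D 0) (dW'_ne c.D 0) (SInstance.hpos_GOG V c hc).2.2.1)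
              (lineX₀ V (dW' c.D 0) (dW'_real c.D 0) (dW'_ne c.D 0) (SInstance.hpos_GOG V c hc).2.2.1) 1)
            (SupplyInstance.testFun (↥(NumberField.maximalRealSubfield (L : Type))) (Fin 3)
              (linePhi V (dW' c.D 1) (dW'_real c.D 1) (dW'_ne c.D 1) (SInstance.hpos_GOG V c hc).2.2.2)
              (lineX₀ V (dW' c.D 1) (dW'_real c.D 1) (dW'_ne c.D 1) (SInstance.hpos_GOG V c hc).2.2.2) 1) =
          piSchwartzBruhatEquiv (↥(NumberField.maximalRealSubfield (L : Type))) (Fin (3 * 2)) (Y ⊗ₜ F) ∧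
        Y = a • HypCensus.cmArchWeilRep (L : Type) finProdFinEquiv (frameD V) (frameD_real V) (frameD_ne V) (dW c.D) (dW_real c.D) (dW_ne c.D)
          (hGR V c) (1, conjTransportK c.D) (ctxSlotArchBox V c (SInstance.hpos_GOG V c hc).1 (SInstance.hpos_GOG V c hc).2.1))
    (hR : DeligneMilne1982_Thm_6_20_full)
    (hΘ : ∀ {L : CMField} {ι₁ : L →+* ℂ} (V : HermSpace3 L ι₁) (c : SeesawCtx L),
      (thetaModelOf hHD hI h₁ (cmAbelianVarietyRealised_of_eigenbasis hHD hI h₃) (orientBitι L ι₁) (embOf hHD hI h₁ (cmAbelianVarietyRealised_of_eigenbasis hHD hI h₃)) (coverOf hHD hI h₁ (cmAbelianVarietyRealised_of_eigenbasis hHD hI h₃) hA) (wmOfInput W) (thetaOf _ (thetaClassInputOf _ (fun V c => thetaSpaceInputOf hHD hI h₁ (cmAbelianVarietyRealised_of_eigenbasis hHD hI h₃) (SInstance.SROGTC @hGR @hGR₀ @hGR₁ @hGR₂ @hGR₃ (ArchSideTerm.muSharp₂₃ @μ) (ArchSideTerm.hΔ₁_GOG_muSharp₂₃ @hGR @hGR₀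 @hGR₁ @hGR₂ @hGR₃ @μ) (ArchSideTerm.hΔ₂_GOG_muSharp₂₃ @hGR @hGR₀ @hGR₁ @hGR₂ @hGR₃ @μ hSV) (ArchSideTerm.hΔ₃_GOG_muSharp₂₃ @hGR @hGR₀ @hGR₁ @hGR₂ @hGR₃ @μ hSV)) V c))) (d12Of (ArchSideTerm.muSharp₂₃ @μ)) (d34Of (ArchSideTerm.muSharp₂₃ @μ))).GoodCtx ι₁ c → Module.finrank ℚ c.K = 6 ∧ IsNormalClosure ℚ c.K L ∧ (Module.finrank ℚ L = 24 ∨ Module.finrank ℚ L = 48) →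
      (NumberField.InfinitePlace.mk ι₁).embedding = ι₁ →
      ∀ i : Fin 4, ∃ Γ₀ : Level V, ∀ Γ ≤ Γ₀,
        ∃ D : CommonReflexInput c.K (c.Ψ i) c.σ,
          (thetaModelOf hHD hI h₁ (cmAbelianVarietyRealised_of_eigenbasis hHD hI h₃) (orientBitι L ι₁) (embOf hHD hI h₁ (cmAbelianVarietyRealised_of_eigenbasis hHD hI h₃)) (coverOf hHD hI h₁ (cmAbelianVarietyRealised_of_eigenbasis hHD hI h₃) hA) (wmOfInput W) (thetaOf _ (thetaClassInputOf _ (fun V c => thetaSpaceInputOf hHD hI h₁ (cmAbelianVarietyRealised_of_eigenbasis hHD hI h₃) (SInstance.SROGTC @hGR @hGR₀ @hGR₁ @hGR₂ @hGR₃ (ArchSideTerm.muSharp₂₃ @μ) (ArchSideTerm.hΔ₁_GOG_muSharp₂₃ @hGR @hGR₀ @hGR₁ @hGR₂ @hGR₃ @μ) (ArchSideTerm.hΔ₂_GOG_muSharp₂₃ @hGR @hGR₀ @hGR₁ @hGR₂ @hGR₃ @μ hSV) (ArchSideTerm.hΔ₃_GOG_muSharp₂₃ @hGR @hGR₀ @hGR₁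 @hGR₂ @hGR₃ @μ hSV)) V c))) (d12Of (ArchSideTerm.muSharp₂₃ @μ)) (d34Of (ArchSideTerm.muSharp₂₃ @μ))).Theta V c i Γ ⊆
            Submodule.span ℂ (D.surfaceClasses hHD hI h₁ (cmAbelianVarietyRealised_of_eigenbasis hHD hI h₃) V Γ))
    (gen12 : ∀ {L : CMField} {ι₁ : L →+* ℂ} (V : HermSpace3 L ι₁) (c : SeesawCtx L),
      (thetaModelOf hHD hI h₁ (cmAbelianVarietyRealised_of_eigenbasis hHD hI h₃) (orientBitι L ι₁) (embOf hHD hI h₁ (cmAbelianVarietyRealised_of_eigenbasis hHD hI h₃)) (coverOf hHD hI h₁ (cmAbelianVarietyRealised_of_eigenbasis hHD hI h₃) hA) (wmOfInput W) (thetaOf _ (thetaClassInputOf _ (fun V c => thetaSpaceInputOf hHD hI h₁ (cmAbelianVarietyRealised_of_eigenbasis hHD hI h₃) (SInstance.SROGTC @hGR @hGR₀ @hGR₁ @hGR₂ @hGR₃ (ArchSideTerm.muSharp₂₃ @μ) (ArchSideTerm.hΔ₁_GOG_muSharp₂₃ @hGR @hGR₀ @hGR₁ @hGR₂ @hGR₃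 @μ) (ArchSideTerm.hΔ₂_GOG_muSharp₂₃ @hGR @hGR₀ @hGR₁ @hGR₂ @hGR₃ @μ hSV) (ArchSideTerm.hΔ₃_GOG_muSharp₂₃ @hGR @hGR₀ @hGR₁ @hGR₂ @hGR₃ @μ hSV)) V c))) (d12Of (ArchSideTerm.muSharp₂₃ @μ)) (d34Of (ArchSideTerm.muSharp₂₃ @μ))).GoodCtx ι₁ c → Module.finrank ℚ c.K = 6 ∧ IsNormalClosure ℚ c.K L ∧ (Module.finrank ℚ L = 24 ∨ Module.finrank ℚ L = 48) →
      (NumberField.InfinitePlace.mk ι₁).embedding = ι₁ →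
      Nonempty ((thetaModelOf hHD hI h₁ (cmAbelianVarietyRealised_of_eigenbasis hHD hI h₃) (orientBitι L ι₁) (embOf hHD hI h₁ (cmAbelianVarietyRealised_of_eigenbasis hHD hI h₃)) (coverOf hHD hI h₁ (cmAbelianVarietyRealised_of_eigenbasis hHD hI h₃) hA) (wmOfInput W) (thetaOf _ (thetaClassInputOf _ (fun V c => thetaSpaceInputOf hHD hI h₁ (cmAbelianVarietyRealised_of_eigenbasis hHD hI h₃) (SInstance.SROGTC @hGR @hGR₀ @hGR₁ @hGR₂ @hGR₃ (ArchSideTerm.muSharp₂₃ @μ) (ArchSideTerm.hΔ₁_GOG_muSharp₂₃ @hGR @hGR₀ @hGR₁ @hGR₂ @hGR₃ @μ) (ArchSideTerm.hΔ₂_GOG_muSharp₂₃ @hGR @hGR₀ @hGR₁ @hGR₂ @hGR₃ @μ hSV) (ArchSideTerm.hΔ₃_GOG_muSharp₂₃ @hGR @hGR₀ @hGR₁ @hGR₂ @hGR₃ @μ hSV)) V c))) (d12Of (ArchSideTerm.muSharp₂₃ @μ)) (d34Of (ArchSideTerm.muSharp₂₃ @μ))).Gen12FunBridge V c))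
    (real34 : ∀ {L : CMField} {ι₁ : L →+* ℂ} (V : HermSpace3 L ι₁) (c : SeesawCtx L),
      (thetaModelOf hHD hI h₁ (cmAbelianVarietyRealised_of_eigenbasis hHD hI h₃) (orientBitι L ι₁) (embOf hHD hI h₁ (cmAbelianVarietyRealised_of_eigenbasis hHD hI h₃)) (coverOf hHD hI h₁ (cmAbelianVarietyRealised_of_eigenbasis hHD hI h₃) hA) (wmOfInput W) (thetaOf _ (thetaClassInputOf _ (fun V c => thetaSpaceInputOf hHD hI h₁ (cmAbelianVarietyRealised_of_eigenbasis hHD hI h₃) (SInstance.SROGTC @hGR @hGR₀ @hGR₁ @hGR₂ @hGR₃ (ArchSideTerm.muSharp₂₃ @μ) (ArchSideTerm.hΔ₁_GOG_muSharp₂₃ @hGR @hGR₀ @hGR₁ @hGR₂ @hGR₃ @μ) (ArchSideTerm.hΔ₂_GOG_muSharp₂₃ @hGR @hGR₀ @hGR₁ @hGR₂ @hGR₃ @μ hSV) (ArchSideTerm.hΔ₃_GOG_muSharp₂₃ @hGR @hGR₀ @hGR₁ @hGR₂ @hGR₃ @μ hSV)) V c))) (d12Of (ArchSideTerm.muSharp₂₃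 @μ)) (d34Of (ArchSideTerm.muSharp₂₃ @μ))).GoodCtx ι₁ c → Module.finrank ℚ c.K = 6 ∧ IsNormalClosure ℚ c.K L ∧ (Module.finrank ℚ L = 24 ∨ Module.finrank ℚ L = 48) →
      (NumberField.InfinitePlace.mk ι₁).embedding = ι₁ →
      Nonempty ((thetaModelOf hHD hI h₁ (cmAbelianVarietyRealised_of_eigenbasis hHD hI h₃) (orientBitι L ι₁) (embOf hHD hI h₁ (cmAbelianVarietyRealised_of_eigenbasis hHD hI h₃)) (coverOf hHD hI h₁ (cmAbelianVarietyRealised_of_eigenbasis hHD hI h₃) hA) (wmOfInput W) (thetaOf _ (thetaClassInputOf _ (fun V c => thetaSpaceInputOf hHD hI h₁ (cmAbelianVarietyRealised_of_eigenbasis hHD hI h₃) (SInstance.SROGTC @hGR @hGR₀ @hGR₁ @hGR₂ @hGR₃ (ArchSideTerm.muSharp₂₃ @μ) (ArchSideTerm.hΔ₁_GOG_muSharp₂₃ @hGR @hGR₀ @hGR₁ @hGR₂ @hGR₃ @μ) (ArchSideTerm.hΔ₂_GOG_muSharp₂₃ @hGR @hGR₀ @hGR₁ @hGR₂ @hGR₃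 @μ hSV) (ArchSideTerm.hΔ₃_GOG_muSharp₂₃ @hGR @hGR₀ @hGR₁ @hGR₂ @hGR₃ @μ hSV)) V c))) (d12Of (ArchSideTerm.muSharp₂₃ @μ)) (d34Of (ArchSideTerm.muSharp₂₃ @μ))).Real34FunBridge V c))
    (hyp12 : ∀ {L : CMField} {ι₁ : L →+* ℂ} (V : HermSpace3 L ι₁) (c : SeesawCtx L),
      (thetaModelOf hHD hI h₁ (cmAbelianVarietyRealised_of_eigenbasis hHD hI h₃) (orientBitι L ι₁) (embOf hHD hI h₁ (cmAbelianVarietyRealised_of_eigenbasis hHD hI h₃)) (coverOf hHD hI h₁ (cmAbelianVarietyRealised_of_eigenbasis hHD hI h₃) hA) (wmOfInput W) (thetaOf _ (thetaClassInputOf _ (fun V c => thetaSpaceInputOf hHD hI h₁ (cmAbelianVarietyRealised_of_eigenbasis hHD hI h₃) (SInstance.SROGTC @hGR @hGR₀ @hGR₁ @hGR₂ @hGR₃ (ArchSideTerm.muSharp₂₃ @μ) (ArchSideTerm.hΔ₁_GOG_muSharp₂₃ @hGR @hGR₀ @hGR₁ @hGR₂ @hGR₃ @μ) (ArchSideTerm.hΔ₂_GOG_muSharp₂₃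 @hGR @hGR₀ @hGR₁ @hGR₂ @hGR₃ @μ hSV) (ArchSideTerm.hΔ₃_GOG_muSharp₂₃ @hGR @hGR₀ @hGR₁ @hGR₂ @hGR₃ @μ hSV)) V c))) (d12Of (ArchSideTerm.muSharp₂₃ @μ)) (d34Of (ArchSideTerm.muSharp₂₃ @μ))).GoodCtx ι₁ c → Module.finrank ℚ c.K = 6 ∧ IsNormalClosure ℚ c.K L ∧ (Module.finrank ℚ L = 24 ∨ Module.finrank ℚ L = 48) →
      (NumberField.InfinitePlace.mk ι₁).embedding = ι₁ →
      Nonempty (((coreOf _ (embOf hHD hI h₁ (cmAbelianVarietyRealised_of_eigenbasis hHD hI h₃)) (coverOf hHD hI h₁ (cmAbelianVarietyRealised_of_eigenbasis hHD hI h₃) hA) (wmOfInput W) (thetaOf _ (thetaClassInputOf _ (fun V c => thetaSpaceInputOf hHD hI h₁ (cmAbelianVarietyRealised_of_eigenbasis hHD hI h₃) (SInstance.SROGTC @hGR @hGR₀ @hGR₁ @hGR₂ @hGR₃ (ArchSideTerm.muSharp₂₃ @μ) (ArchSideTerm.hΔ₁_GOG_muSharp₂₃ @hGR @hGR₀ @hGR₁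 @hGR₂ @hGR₃ @μ) (ArchSideTerm.hΔ₂_GOG_muSharp₂₃ @hGR @hGR₀ @hGR₁ @hGR₂ @hGR₃ @μ hSV) (ArchSideTerm.hΔ₃_GOG_muSharp₂₃ @hGR @hGR₀ @hGR₁ @hGR₂ @hGR₃ @μ hSV)) V c)))).toCore (orientBitι L ι₁)).HypSmoothCore12
        (((coreOf _ (embOf hHD hI h₁ (cmAbelianVarietyRealised_of_eigenbasis hHD hI h₃)) (coverOf hHD hI h₁ (cmAbelianVarietyRealised_of_eigenbasis hHD hI h₃) hA) (wmOfInput W) (thetaOf _ (thetaClassInputOf _ (fun V c => thetaSpaceInputOf hHD hI h₁ (cmAbelianVarietyRealised_of_eigenbasis hHD hI h₃) (SInstance.SROGTC @hGR @hGR₀ @hGR₁ @hGR₂ @hGR₃ (ArchSideTerm.muSharp₂₃ @μ) (ArchSideTerm.hΔ₁_GOG_muSharp₂₃ @hGR @hGR₀ @hGR₁ @hGR₂ @hGR₃ @μ) (ArchSideTerm.hΔ₂_GOG_muSharp₂₃ @hGR @hGR₀ @hGR₁ @hGR₂ @hGR₃ @μ hSV) (ArchSideTerm.hΔ₃_GOG_muSharp₂₃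 @hGR @hGR₀ @hGR₁ @hGR₂ @hGR₃ @μ hSV)) V c)))).toCore (orientBitι L ι₁)).side12 (d12Of (ArchSideTerm.muSharp₂₃ @μ))) (((coreOf _ (embOf hHD hI h₁ (cmAbelianVarietyRealised_of_eigenbasis hHD hI h₃)) (coverOf hHD hI h₁ (cmAbelianVarietyRealised_of_eigenbasis hHD hI h₃) hA) (wmOfInput W) (thetaOf _ (thetaClassInputOf _ (fun V c => thetaSpaceInputOf hHD hI h₁ (cmAbelianVarietyRealised_of_eigenbasis hHD hI h₃) (SInstance.SROGTC @hGR @hGR₀ @hGR₁ @hGR₂ @hGR₃ (ArchSideTerm.muSharp₂₃ @μ) (ArchSideTerm.hΔ₁_GOG_muSharp₂₃ @hGR @hGR₀ @hGR₁ @hGR₂ @hGR₃ @μ) (ArchSideTerm.hΔ₂_GOG_muSharp₂₃ @hGR @hGR₀ @hGR₁ @hGR₂ @hGR₃ @μ hSV) (ArchSideTerm.hΔ₃_GOG_muSharp₂₃ @hGR @hGR₀ @hGR₁ @hGR₂ @hGR₃ @μ hSV)) V c)))).toCore (orientBitι L ι₁)).side34 (d34Of (ArchSideTerm.muSharp₂₃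 @μ)))
        ((((coreOf _ (embOf hHD hI h₁ (cmAbelianVarietyRealised_of_eigenbasis hHD hI h₃)) (coverOf hHD hI h₁ (cmAbelianVarietyRealised_of_eigenbasis hHD hI h₃) hA) (wmOfInput W) (thetaOf _ (thetaClassInputOf _ (fun V c => thetaSpaceInputOf hHD hI h₁ (cmAbelianVarietyRealised_of_eigenbasis hHD hI h₃) (SInstance.SROGTC @hGR @hGR₀ @hGR₁ @hGR₂ @hGR₃ (ArchSideTerm.muSharp₂₃ @μ) (ArchSideTerm.hΔ₁_GOG_muSharp₂₃ @hGR @hGR₀ @hGR₁ @hGR₂ @hGR₃ @μ) (ArchSideTerm.hΔ₂_GOG_muSharp₂₃ @hGR @hGR₀ @hGR₁ @hGR₂ @hGR₃ @μ hSV) (ArchSideTerm.hΔ₃_GOG_muSharp₂₃ @hGR @hGR₀ @hGR₁ @hGR₂ @hGR₃ @μ hSV)) V c)))).toCore (orientBitι L ι₁)).analyticKM (((coreOf _ (embOf hHD hI h₁ (cmAbelianVarietyRealised_of_eigenbasis hHD hI h₃)) (coverOf hHD hI h₁ (cmAbelianVarietyRealised_of_eigenbasis hHD hI h₃) hA) (wmOfInput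 W) (thetaOf _ (thetaClassInputOf _ (fun V c => thetaSpaceInputOf hHD hI h₁ (cmAbelianVarietyRealised_of_eigenbasis hHD hI h₃) (SInstance.SROGTC @hGR @hGR₀ @hGR₁ @hGR₂ @hGR₃ (ArchSideTerm.muSharp₂₃ @μ) (ArchSideTerm.hΔ₁_GOG_muSharp₂₃ @hGR @hGR₀ @hGR₁ @hGR₂ @hGR₃ @μ) (ArchSideTerm.hΔ₂_GOG_muSharp₂₃ @hGR @hGR₀ @hGR₁ @hGR₂ @hGR₃ @μ hSV) (ArchSideTerm.hΔ₃_GOG_muSharp₂₃ @hGR @hGR₀ @hGR₁ @hGR₂ @hGR₃ @μ hSV)) V c)))).toCore (orientBitι L ι₁)).side12 (d12Of (ArchSideTerm.muSharp₂₃ @μ)))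
          (((coreOf _ (embOf hHD hI h₁ (cmAbelianVarietyRealised_of_eigenbasis hHD hI h₃)) (coverOf hHD hI h₁ (cmAbelianVarietyRealised_of_eigenbasis hHD hI h₃) hA) (wmOfInput W) (thetaOf _ (thetaClassInputOf _ (fun V c => thetaSpaceInputOf hHD hI h₁ (cmAbelianVarietyRealised_of_eigenbasis hHD hI h₃) (SInstance.SROGTC @hGR @hGR₀ @hGR₁ @hGR₂ @hGR₃ (ArchSideTerm.muSharp₂₃ @μ) (ArchSideTerm.hΔ₁_GOG_muSharp₂₃ @hGR @hGR₀ @hGR₁ @hGR₂ @hGR₃ @μ) (ArchSideTerm.hΔ₂_GOG_muSharp₂₃ @hGR @hGR₀ @hGR₁ @hGR₂ @hGR₃ @μ hSV) (ArchSideTerm.hΔ₃_GOG_muSharp₂₃ @hGR @hGR₀ @hGR₁ @hGR₂ @hGR₃ @μ hSV)) V c)))).toCore (orientBitι L ι₁)).side34 (d34Of (ArchSideTerm.muSharp₂₃ @μ)))).toAnalytic) V c (ℓ := linOfInput W V c)))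
    (hyp34 : ∀ {L : CMField} {ι₁ : L →+* ℂ} (V : HermSpace3 L ι₁) (c : SeesawCtx L),
      (thetaModelOf hHD hI h₁ (cmAbelianVarietyRealised_of_eigenbasis hHD hI h₃) (orientBitι L ι₁) (embOf hHD hI h₁ (cmAbelianVarietyRealised_of_eigenbasis hHD hI h₃)) (coverOf hHD hI h₁ (cmAbelianVarietyRealised_of_eigenbasis hHD hI h₃) hA) (wmOfInput W) (thetaOf _ (thetaClassInputOf _ (fun V c => thetaSpaceInputOf hHD hI h₁ (cmAbelianVarietyRealised_of_eigenbasis hHD hI h₃) (SInstance.SROGTC @hGR @hGR₀ @hGR₁ @hGR₂ @hGR₃ (ArchSideTerm.muSharp₂₃ @μ) (ArchSideTerm.hΔ₁_GOG_muSharp₂₃ @hGR @hGR₀ @hGR₁ @hGR₂ @hGR₃ @μ) (ArchSideTerm.hΔ₂_GOG_muSharp₂₃ @hGR @hGR₀ @hGR₁ @hGR₂ @hGR₃ @μ hSV) (ArchSideTerm.hΔ₃_GOG_muSharp₂₃ @hGR @hGR₀ @hGR₁ @hGR₂ @hGR₃ @μ hSV)) V c))) (d12Of (ArchSideTerm.muSharp₂₃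 @μ)) (d34Of (ArchSideTerm.muSharp₂₃ @μ))).GoodCtx ι₁ c → Module.finrank ℚ c.K = 6 ∧ IsNormalClosure ℚ c.K L ∧ (Module.finrank ℚ L = 24 ∨ Module.finrank ℚ L = 48) →
      (NumberField.InfinitePlace.mk ι₁).embedding = ι₁ →
      Nonempty (((coreOf _ (embOf hHD hI h₁ (cmAbelianVarietyRealised_of_eigenbasis hHD hI h₃)) (coverOf hHD hI h₁ (cmAbelianVarietyRealised_of_eigenbasis hHD hI h₃) hA) (wmOfInput W) (thetaOf _ (thetaClassInputOf _ (fun V c => thetaSpaceInputOf hHD hI h₁ (cmAbelianVarietyRealised_of_eigenbasis hHD hI h₃) (SInstance.SROGTC @hGR @hGR₀ @hGR₁ @hGR₂ @hGR₃ (ArchSideTerm.muSharp₂₃ @μ) (ArchSideTerm.hΔ₁_GOG_muSharp₂₃ @hGR @hGR₀ @hGR₁ @hGR₂ @hGR₃ @μ) (ArchSideTerm.hΔ₂_GOG_muSharp₂₃ @hGR @hGR₀ @hGR₁ @hGR₂ @hGR₃ @μ hSV) (ArchSideTerm.hΔ₃_GOG_muSharp₂₃ @hGR @hGR₀ @hGR₁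 @hGR₂ @hGR₃ @μ hSV)) V c)))).toCore (orientBitι L ι₁)).HypSmoothCore34
        (((coreOf _ (embOf hHD hI h₁ (cmAbelianVarietyRealised_of_eigenbasis hHD hI h₃)) (coverOf hHD hI h₁ (cmAbelianVarietyRealised_of_eigenbasis hHD hI h₃) hA) (wmOfInput W) (thetaOf _ (thetaClassInputOf _ (fun V c => thetaSpaceInputOf hHD hI h₁ (cmAbelianVarietyRealised_of_eigenbasis hHD hI h₃) (SInstance.SROGTC @hGR @hGR₀ @hGR₁ @hGR₂ @hGR₃ (ArchSideTerm.muSharp₂₃ @μ) (ArchSideTerm.hΔ₁_GOG_muSharp₂₃ @hGR @hGR₀ @hGR₁ @hGR₂ @hGR₃ @μ) (ArchSideTerm.hΔ₂_GOG_muSharp₂₃ @hGR @hGR₀ @hGR₁ @hGR₂ @hGR₃ @μ hSV) (ArchSideTerm.hΔ₃_GOG_muSharp₂₃ @hGR @hGR₀ @hGR₁ @hGR₂ @hGR₃ @μ hSV)) V c)))).toCore (orientBitι L ι₁)).side12 (d12Of (ArchSideTerm.muSharp₂₃ @μ))) (((coreOf _ (embOf hHD hI h₁ (cmAbelianVarietyRealised_of_eigenbasis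 hHD hI h₃)) (coverOf hHD hI h₁ (cmAbelianVarietyRealised_of_eigenbasis hHD hI h₃) hA) (wmOfInput W) (thetaOf _ (thetaClassInputOf _ (fun V c => thetaSpaceInputOf hHD hI h₁ (cmAbelianVarietyRealised_of_eigenbasis hHD hI h₃) (SInstance.SROGTC @hGR @hGR₀ @hGR₁ @hGR₂ @hGR₃ (ArchSideTerm.muSharp₂₃ @μ) (ArchSideTerm.hΔ₁_GOG_muSharp₂₃ @hGR @hGR₀ @hGR₁ @hGR₂ @hGR₃ @μ) (ArchSideTerm.hΔ₂_GOG_muSharp₂₃ @hGR @hGR₀ @hGR₁ @hGR₂ @hGR₃ @μ hSV) (ArchSideTerm.hΔ₃_GOG_muSharp₂₃ @hGR @hGR₀ @hGR₁ @hGR₂ @hGR₃ @μ hSV)) V c)))).toCore (orientBitι L ι₁)).side34 (d34Of (ArchSideTerm.muSharp₂₃ @μ)))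
        ((((coreOf _ (embOf hHD hI h₁ (cmAbelianVarietyRealised_of_eigenbasis hHD hI h₃)) (coverOf hHD hI h₁ (cmAbelianVarietyRealised_of_eigenbasis hHD hI h₃) hA) (wmOfInput W) (thetaOf _ (thetaClassInputOf _ (fun V c => thetaSpaceInputOf hHD hI h₁ (cmAbelianVarietyRealised_of_eigenbasis hHD hI h₃) (SInstance.SROGTC @hGR @hGR₀ @hGR₁ @hGR₂ @hGR₃ (ArchSideTerm.muSharp₂₃ @μ) (ArchSideTerm.hΔ₁_GOG_muSharp₂₃ @hGR @hGR₀ @hGR₁ @hGR₂ @hGR₃ @μ) (ArchSideTerm.hΔ₂_GOG_muSharp₂₃ @hGR @hGR₀ @hGR₁ @hGR₂ @hGR₃ @μ hSV) (ArchSideTerm.hΔ₃_GOG_muSharp₂₃ @hGR @hGR₀ @hGR₁ @hGR₂ @hGR₃ @μ hSV)) V c)))).toCore (orientBitι L ι₁)).analyticKM (((coreOf _ (embOf hHD hI h₁ (cmAbelianVarietyRealised_of_eigenbasis hHD hI h₃)) (coverOf hHD hI h₁ (cmAbelianVarietyRealised_of_eigenbasis hHD hI h₃) hA) (wmOfInput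 W) (thetaOf _ (thetaClassInputOf _ (fun V c => thetaSpaceInputOf hHD hI h₁ (cmAbelianVarietyRealised_of_eigenbasis hHD hI h₃) (SInstance.SROGTC @hGR @hGR₀ @hGR₁ @hGR₂ @hGR₃ (ArchSideTerm.muSharp₂₃ @μ) (ArchSideTerm.hΔ₁_GOG_muSharp₂₃ @hGR @hGR₀ @hGR₁ @hGR₂ @hGR₃ @μ) (ArchSideTerm.hΔ₂_GOG_muSharp₂₃ @hGR @hGR₀ @hGR₁ @hGR₂ @hGR₃ @μ hSV) (ArchSideTerm.hΔ₃_GOG_muSharp₂₃ @hGR @hGR₀ @hGR₁ @hGR₂ @hGR₃ @μ hSV)) V c)))).toCore (orientBitι L ι₁)).side12 (d12Of (ArchSideTerm.muSharp₂₃ @μ)))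
          (((coreOf _ (embOf hHD hI h₁ (cmAbelianVarietyRealised_of_eigenbasis hHD hI h₃)) (coverOf hHD hI h₁ (cmAbelianVarietyRealised_of_eigenbasis hHD hI h₃) hA) (wmOfInput W) (thetaOf _ (thetaClassInputOf _ (fun V c => thetaSpaceInputOf hHD hI h₁ (cmAbelianVarietyRealised_of_eigenbasis hHD hI h₃) (SInstance.SROGTC @hGR @hGR₀ @hGR₁ @hGR₂ @hGR₃ (ArchSideTerm.muSharp₂₃ @μ) (ArchSideTerm.hΔ₁_GOG_muSharp₂₃ @hGR @hGR₀ @hGR₁ @hGR₂ @hGR₃ @μ) (ArchSideTerm.hΔ₂_GOG_muSharp₂₃ @hGR @hGR₀ @hGR₁ @hGR₂ @hGR₃ @μ hSV) (ArchSideTerm.hΔ₃_GOG_muSharp₂₃ @hGR @hGR₀ @hGR₁ @hGR₂ @hGR₃ @μ hSV)) V c)))).toCore (orientBitι L ι₁)).side34 (d34Of (ArchSideTerm.muSharp₂₃ @μ)))).toAnalytic) V c (ℓ := linOfInput W V c))) :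
     (picardCMUniverse hHD hI h₁ (cmAbelianVarietyRealised_of_eigenbasis hHD hI h₃)).PerL :=
  perL_picardCM_r21AEOGISTRD hHD hI h₁ h₃ hA W hGR hGR₀ hGR₁ hGR₂ hGR₃ (ArchSideTerm.muSharp₂₃ @μ)
    (ArchSideTerm.hΔ₁_GOG_muSharp₂₃ @hGR @hGR₀ @hGR₁ @hGR₂ @hGR₃ @μ) (ArchSideTerm.hΔ₂_GOG_muSharp₂₃ @hGR @hGR₀ @hGR₁ @hGR₂ @hGR₃ @μ hSV)
    (ArchSideTerm.hΔ₃_GOG_muSharp₂₃ @hGR @hGR₀ @hGR₁ @hGR₂ @hGR₃ @μ hSV) hR hΘ gen12 real34 hyp12 hyp34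

end Model

end HodgeCM
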